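import Summits.ValiantsHypothesis.ValiantsHypothesis.Theorems.DefinabilityGapUnitRigidityWords
import Summits.ValiantsHypothesis.ValiantsHypothesis.Theorems.DefinabilityGapZperTransfer
import HarnessLib

/-!
# DefinabilityGap — UNIT RIGIDITY, stage S2: unit links (`chainVal_eq_zero_of_isUnit_det`)

Last file of the series S1a / S1b / S2 (decomp-valiant bus, OFFER O-L5-UR, CALL l.1120 «UNIT LINKS»; target =
named cell 1044 (b): the unit-links sub-case of the leaf `hZ` of
`DefinabilityGapZperTransfer.chainVal_eq_zero_of_bind₁_kiPer`, in the kernel).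

THEOREM (`chainVal_eq_zero_of_isUnit_det`). `K` a field, `c < m`, `l` a list of univariate-image links
`ulink (M_j, ℓ_j) = M_j(ℓ_j)` with `M_j ∈ GL₂(K[t])` (`IsUnit M_j.det`) and `|vars ℓ_j| ≤ c`, `u, v ∈ K²`:
`per_m ∣ uᵀ M_1(ℓ_1) ⋯ M_N(ℓ_N) v ⇒ uᵀ M_1(ℓ_1) ⋯ M_N(ℓ_N) v = 0` — every length `N`, every `m > c`.
`zperHits_of_isUnit_det` is the literal `c = 2`, `m ≥ 3` instance: the leaf's hypothesis `hZ` restricted to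
unit links.

Proof. (1) `GL₂(K[t]) = GE₂(K[t])` (Cohn 1966; Euclid on column `0`): every `M` with unit determinant is the
matrix `wmat K w` of a word of letters `T(a, κ, μ) = E(a) · diag(κ, μ)`, `a ∈ K[t]`, `κ, μ ∈ Kˣ`
(`exists_word_of_isUnit_det`, induction on `natDegree M₀₀`: `N = E(-q) · M` has `N₀₀ = M₁₀ mod M₀₀` and
`M = E(0) E(q) E(0) · N`; base `M₀₀ = 0`: `M = T(0,1,-b) · T(-s,1,1) · T(0,r,1)`). (2) Words map to words under
the `K`-algebra map `t ↦ ℓ` (`wmat_map`), the letters becoming `c`-local (`aeval_mem_locSpan`, S1a).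
(3) `uᵀ W v = (U · W · V)₀₁` for boundary words `U, V` of at most two constant letters (`exists_row_word`,
`exists_col_word`, `entry_eq_chainVal`). (4) S1b's `wmat_zero_one_eq_zero` on the word `U ++ w ++ V`.

HONEST GRADE (critic, l.1120): Allender–Wang's indg mechanism (Bringmann–Ikenmeyer–Zuiddam JACM 2018 Thm 5.6)
transplanted to «top form prime to `per_m` inside the `c`-local span» + Cohn `GE₂` rewriting keeping entries
`c`-local; size-free; NOT covered: non-unit links (`δ ≥ 1`, where voids exist) and non-univariate 2-local unit
matrices; kernel sub-case of the leaf `hZ`; closes no item; 0 S-currency; rung 0; VP ≠ VNP untouched.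
No facts, no Prop-valued definitions, no placeholders, no new data definitions.
-/

open MvPolynomial Finset
open Literature.Computability.AlgebraicComplexity
open Summit.ValiantsHypothesis.ValiantsHypothesis.Theorems.DefinabilityGapUnitRigidityForms
open Summit.ValiantsHypothesis.ValiantsHypothesis.Theorems.DefinabilityGapUnitRigidityWords
open Summit.ValiantsHypothesis.ValiantsHypothesis.Theorems.DefinabilityGapZperTransfer

namespace Summit.ValiantsHypothesis.ValiantsHypothesis.Theorems.DefinabilityGapUnitRigidity

noncomputable section

variable {K : Type*} [Field K]

/-! ## 1. Small matrix facts -/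

section Generic

variable {A : Type*} [CommRing A]

/-- `diag(1, 1) = 1`. [this file] -/
theorem dmat_one_one : dmat (1 : A) 1 = 1 := by
  rw [Matrix.one_fin_two]
  rfl

/-- `det E(a) = 1`. [this file] -/
theorem det_eM (a : A) : (eM a).det = 1 := by
  simp [Matrix.det_fin_two, eM]

/-- The `(0,0)` entry of `E(a) · M` is `a M₀₀ + M₁₀` (one Euclid step on column `0`). [this file] -/
theorem eM_mul_apply_zero_zero (a : A) (M : Matrix (Fin 2) (Fin 2) A) :
    (eM a * M) 0 0 = a * M 0 0 + M 1 0 := by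
  simp [eM, Matrix.mul_apply, Fin.sum_univ_two]

/-- `E(0) E(q) E(0) E(-q) = 1` (`E(q)⁻¹ = E(0) E(-q) E(0)`, Cohn). [this file] -/
theorem eM_zero_mul_eM_mul_eM_zero_mul_eM_neg (q : A) : eM 0 * eM q * eM 0 * eM (-q) = 1 := by
  rw [Matrix.one_fin_two]
  simp only [eM, Matrix.mul_fin_two]
  exact fin_two_eq (by ring) (by ring) (by ring) (by ring)

end Generic

/-! ## 2. `GL₂(K[t]) = GE₂(K[t])`: unit-determinant matrices are words -/

section GE2

/-- Base case: a unit-determinant `M` with `M₀₀ = 0` is `[[0, C b], [C r, s]] = T(0,1,-b) T(-s,1,1) T(0,r,1)`.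
[this file] -/
theorem exists_word_of_apply_eq_zero (M : Matrix (Fin 2) (Fin 2) (Polynomial K)) (hM : IsUnit M.det)
    (h0 : M 0 0 = 0) :
    ∃ w : List (Polynomial K × K × K), (∀ t ∈ w, t.2.1 ≠ 0 ∧ t.2.2 ≠ 0) ∧ wmat K w = M := by
  rw [Matrix.det_fin_two, h0, zero_mul, zero_sub, IsUnit.neg_iff, IsUnit.mul_iff] at hM
  obtain ⟨b, hb, hb'⟩ := Polynomial.isUnit_iff.1 hM.1
  obtain ⟨r, hr, hr'⟩ := Polynomial.isUnit_iff.1 hM.2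
  obtain ⟨s, hs⟩ : ∃ s : Polynomial K, M 1 1 = s := ⟨_, rfl⟩
  have hM' : M = !![0, Polynomial.C b; Polynomial.C r, s] := by
    rw [← h0, hb', hr', ← hs]
    exact Matrix.eta_fin_two M
  refine ⟨[(0, 1, -b), (-s, 1, 1), (0, r, 1)], ?_, ?_⟩
  · intro t ht
    simp only [List.mem_cons, List.not_mem_nil, or_false] at ht
    rcases ht with rfl | rfl | rfl
    · exact ⟨one_ne_zero, neg_ne_zero.2 hb.ne_zero⟩
    · exact ⟨one_ne_zero, one_ne_zero⟩
    · exact ⟨hr.ne_zero, one_ne_zero⟩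
  · rw [hM']
    simp only [wmat_cons, wmat_nil, Matrix.mul_one, Polynomial.algebraMap_eq, map_one, map_neg, eM, dmat,
      Matrix.mul_fin_two]
    exact fin_two_eq (by ring) (by ring) (by ring) (by ring)

/-- Euclid's algorithm on column `0`, as a bounded induction. [this file] -/
theorem exists_word_of_isUnit_det_aux (n : ℕ) :
    ∀ M : Matrix (Fin 2) (Fin 2) (Polynomial K), IsUnit M.det → (M 0 0).natDegree < n →
      ∃ w : List (Polynomial K × K × K), (∀ t ∈ w, t.2.1 ≠ 0 ∧ t.2.2 ≠ 0) ∧ wmat K w = M := by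
  induction n with
  | zero => exact fun M _ h => absurd h (Nat.not_lt_zero _)
  | succ n ih =>
    intro M hM hlt
    by_cases h0 : M 0 0 = 0
    · exact exists_word_of_apply_eq_zero M hM h0
    obtain ⟨q, hq⟩ : ∃ q : Polynomial K, q = M 1 0 / M 0 0 := ⟨_, rfl⟩
    obtain ⟨N, hN⟩ : ∃ N : Matrix (Fin 2) (Fin 2) (Polynomial K), N = eM (-q) * M := ⟨_, rfl⟩
    have hN00 : N 0 0 = M 1 0 % M 0 0 := by
      rw [hN, eM_mul_apply_zero_zero, EuclideanDomain.mod_eq_sub_mul_div, hq]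
      ring
    have hNdet : IsUnit N.det := by
      rw [hN, Matrix.det_mul, det_eM, one_mul]
      exact hM
    have hMN : M = eM 0 * (eM q * (eM 0 * N)) := by
      rw [hN]
      simp only [← Matrix.mul_assoc, eM_zero_mul_eM_mul_eM_zero_mul_eM_neg, Matrix.one_mul]
    -- a word for `N`: base case if `N₀₀ = 0`, the induction hypothesis (smaller degree) otherwise
    obtain ⟨w, hw, hwN⟩ : ∃ w : List (Polynomial K × K × K), (∀ t ∈ w, t.2.1 ≠ 0 ∧ t.2.2 ≠ 0) ∧
        wmat K w = N := by
      by_cases hN0 : N 0 0 = 0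
      · exact exists_word_of_apply_eq_zero N hNdet hN0
      · refine ih N hNdet ?_
        have hdeg : (N 0 0).degree < (M 0 0).degree := by
          rw [hN00]
          exact Polynomial.degree_mod_lt _ h0
        have hlt' := Polynomial.natDegree_lt_natDegree hN0 hdeg
        omega
    refine ⟨(0, 1, 1) :: (q, 1, 1) :: (0, 1, 1) :: w, ?_, ?_⟩
    · intro t ht
      simp only [List.mem_cons] at ht
      rcases ht with rfl | rfl | rfl | ht
      · exact ⟨one_ne_zero, one_ne_zero⟩
      · exact ⟨one_ne_zero, one_ne_zero⟩
      · exact ⟨one_ne_zero, one_ne_zero⟩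
      · exact hw t ht
    · rw [wmat_cons, wmat_cons, wmat_cons, hwN, hMN]
      simp only [map_one, dmat_one_one, Matrix.mul_one]

/-- **`GL₂(K[t]) = GE₂(K[t])`** (Cohn 1966, via Euclid's algorithm on column `0`): every `2 × 2` matrix over
`K[t]` with unit determinant is the matrix of a word of letters `T(a, κ, μ)` with `κ, μ ≠ 0`. [this file] -/
theorem exists_word_of_isUnit_det (M : Matrix (Fin 2) (Fin 2) (Polynomial K)) (hM : IsUnit M.det) :
    ∃ w : List (Polynomial K × K × K), (∀ t ∈ w, t.2.1 ≠ 0 ∧ t.2.2 ≠ 0) ∧ wmat K w = M :=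
  exists_word_of_isUnit_det_aux _ M hM (Nat.lt_succ_self _)

end GE2

/-! ## 3. Words map to words under `K`-algebra maps -/

section Map

variable {A B : Type*} [CommRing A] [Algebra K A] [CommRing B] [Algebra K B]

/-- A letter maps to a letter. [this file] -/
theorem letter_map (φ : A →ₐ[K] B) (a : A) (κ μ : K) :
    (eM a * dmat (algebraMap K A κ) (algebraMap K A μ)).map φ =
      eM (φ a) * dmat (algebraMap K B κ) (algebraMap K B μ) := by
  rw [← letter_eq_eM_mul_dmat, ← letter_eq_eM_mul_dmat]
  ext i j
  fin_cases i <;> fin_cases j <;> simp [AlgHom.commutes]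

/-- A word maps to the word of the mapped letters (same scalars). [this file] -/
theorem wmat_map (φ : A →ₐ[K] B) (w : List (A × K × K)) :
    (wmat K w).map φ = wmat K (w.map fun t => (φ t.1, t.2)) := by
  induction w with
  | nil =>
    rw [List.map_nil, wmat_nil, wmat_nil]
    exact Matrix.map_one _ (map_zero φ) (map_one φ)
  | cons t w ih =>
    simp only [List.map_cons, wmat_cons]
    rw [Matrix.map_mul, ih, letter_map]

end Map

/-! ## 4. Boundary words and the chain value as a matrix entry -/

section Boundary

variable (σ : Type*) (c : ℕ)

/-- A word `U` of at most two constant letters with row `0` equal to `u ≠ 0`. [this file] -/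
theorem exists_row_word (u : Fin 2 → K) (hu : u ≠ 0) :
    ∃ U : List (MvPolynomial σ K × K × K), (∀ t ∈ U, t.1 ∈ locSpan K σ c ∧ t.2.1 ≠ 0 ∧ t.2.2 ≠ 0) ∧
      ∀ j, wmat K U 0 j = C (u j) := by
  by_cases h1 : u 1 = 0
  · have h0 : u 0 ≠ 0 := fun h0 => hu (by ext i; fin_cases i <;> simp [h0, h1])
    refine ⟨[(0, 1, -1), (0, u 0, 1)], ?_, ?_⟩
    · intro t ht
      simp only [List.mem_cons, List.not_mem_nil, or_false] at ht
      rcases ht with rfl | rfl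
      · exact ⟨Submodule.zero_mem _, one_ne_zero, neg_ne_zero.2 one_ne_zero⟩
      · exact ⟨Submodule.zero_mem _, h0, one_ne_zero⟩
    · have hw : wmat K [(0, 1, -1), (0, u 0, 1)] =
          (!![C (u 0), 0; 0, -1] : Matrix (Fin 2) (Fin 2) (MvPolynomial σ K)) := by
        simp only [wmat_cons, wmat_nil, Matrix.mul_one, MvPolynomial.algebraMap_eq, map_one, map_neg, eM,
          dmat, Matrix.mul_fin_two]
        exact fin_two_eq (by ring) (by ring) (by ring) (by ring)
      intro j
      rw [hw]
      fin_cases j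
      · simp
      · simp [h1]
  · refine ⟨[(C (u 0), 1, u 1)], ?_, ?_⟩
    · intro t ht
      simp only [List.mem_cons, List.not_mem_nil, or_false] at ht
      subst ht
      exact ⟨C_mem_locSpan c _, one_ne_zero, h1⟩
    · have hw : wmat K [(C (u 0), 1, u 1)] =
          (!![C (u 0), C (u 1); -1, 0] : Matrix (Fin 2) (Fin 2) (MvPolynomial σ K)) := by
        simp only [wmat_cons, wmat_nil, Matrix.mul_one, MvPolynomial.algebraMap_eq, map_one, eM, dmat,
          Matrix.mul_fin_two]
        exact fin_two_eq (by ring) (by ring) (by ring) (by ring)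
      intro j
      rw [hw]
      fin_cases j
      · simp
      · simp

/-- A word `V` of at most two constant letters with column `1` equal to `v ≠ 0`. [this file] -/
theorem exists_col_word (v : Fin 2 → K) (hv : v ≠ 0) :
    ∃ V : List (MvPolynomial σ K × K × K), (∀ t ∈ V, t.1 ∈ locSpan K σ c ∧ t.2.1 ≠ 0 ∧ t.2.2 ≠ 0) ∧
      ∀ i, wmat K V i 1 = C (v i) := by
  by_cases h1 : v 1 = 0
  · have h0 : v 0 ≠ 0 := fun h0 => hv (by ext i; fin_cases i <;> simp [h0, h1])
    refine ⟨[(0, 1, v 0)], ?_, ?_⟩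
    · intro t ht
      simp only [List.mem_cons, List.not_mem_nil, or_false] at ht
      subst ht
      exact ⟨Submodule.zero_mem _, one_ne_zero, h0⟩
    · have hw : wmat K [(0, 1, v 0)] =
          (!![0, C (v 0); -1, 0] : Matrix (Fin 2) (Fin 2) (MvPolynomial σ K)) := by
        simp only [wmat_cons, wmat_nil, Matrix.mul_one, MvPolynomial.algebraMap_eq, map_one, eM, dmat,
          Matrix.mul_fin_two]
        exact fin_two_eq (by ring) (by ring) (by ring) (by ring)
      intro i
      rw [hw]
      fin_cases i
      · simp
      · simp [h1]
  · refine ⟨[(C (-(v 0 * (v 1)⁻¹)), 1, 1), (0, 1, -(v 1))], ?_, ?_⟩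
    · intro t ht
      simp only [List.mem_cons, List.not_mem_nil, or_false] at ht
      rcases ht with rfl | rfl
      · exact ⟨C_mem_locSpan c _, one_ne_zero, one_ne_zero⟩
      · exact ⟨Submodule.zero_mem _, one_ne_zero, neg_ne_zero.2 h1⟩
    · have hvv : C (v 0 * (v 1)⁻¹) * C (v 1) = (C (v 0) : MvPolynomial σ K) := by
        rw [← C_mul, inv_mul_cancel_right₀ h1]
      have hw : wmat K [(C (-(v 0 * (v 1)⁻¹)), 1, 1), (0, 1, -(v 1))] =
          (!![-1, C (v 0); 0, C (v 1)] : Matrix (Fin 2) (Fin 2) (MvPolynomial σ K)) := by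
        simp only [wmat_cons, wmat_nil, Matrix.mul_one, MvPolynomial.algebraMap_eq, map_one, map_neg, eM,
          dmat, Matrix.mul_fin_two]
        exact fin_two_eq (by ring) (by linear_combination hvv) (by ring) (by ring)
      intro i
      rw [hw]
      fin_cases i
      · simp
      · simp

variable {σ c}

/-- The chain value `uᵀ W v` is the `(0,1)` entry of `U · W · V` whenever row `0` of `U` is `u` and column
`1` of `V` is `v`. [this file] -/
theorem entry_eq_chainVal (U V : Matrix (Fin 2) (Fin 2) (MvPolynomial σ K))
    (L : List (Matrix (Fin 2) (Fin 2) (MvPolynomial σ K))) (u v : Fin 2 → K)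
    (hU : ∀ j, U 0 j = C (u j)) (hV : ∀ i, V i 1 = C (v i)) :
    (U * L.prod * V) 0 1 = chainVal L u v := by
  simp only [chainVal, Matrix.mul_apply, Matrix.mulVec, dotProduct, Fin.sum_univ_two, hU, hV]
  ring

/-- Every chain of UNIT univariate-image links with `c`-local arguments is the matrix of a word of `c`-local
letters with non-zero scalars. [this file] -/
theorem exists_word_links (l : List (Matrix (Fin 2) (Fin 2) (Polynomial K) × MvPolynomial σ K))
    (hloc : ∀ e ∈ l, ∃ S : Finset σ, S.card ≤ c ∧ e.2.vars ⊆ S) (hunit : ∀ e ∈ l, IsUnit e.1.det) :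
    ∃ w : List (MvPolynomial σ K × K × K), (∀ t ∈ w, t.1 ∈ locSpan K σ c ∧ t.2.1 ≠ 0 ∧ t.2.2 ≠ 0) ∧
      wmat K w = (l.map ulink).prod := by
  induction l with
  | nil => exact ⟨[], fun t ht => by simp at ht, by simp [wmat_nil]⟩
  | cons e l ih =>
    obtain ⟨w, hw, hwl⟩ := ih (fun e' he' => hloc e' (List.mem_cons_of_mem _ he'))
      (fun e' he' => hunit e' (List.mem_cons_of_mem _ he'))
    obtain ⟨w₁, hw₁, hw₁e⟩ := exists_word_of_isUnit_det e.1 (hunit e (by simp))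
    obtain ⟨S, hS, heS⟩ := hloc e (by simp)
    have hvars : e.2.vars.card ≤ c := (Finset.card_le_card heS).trans hS
    have hmap : wmat K (w₁.map fun t => (Polynomial.aeval e.2 t.1, t.2)) = ulink e := by
      rw [← wmat_map, hw₁e]
      rfl
    refine ⟨(w₁.map fun t => (Polynomial.aeval e.2 t.1, t.2)) ++ w, ?_, ?_⟩
    · intro t ht
      rcases List.mem_append.1 ht with ht | ht
      · obtain ⟨t', ht', rfl⟩ := List.mem_map.1 ht
        exact ⟨aeval_mem_locSpan hvars _, hw₁ t' ht'⟩
      · exact hw t ht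
    · rw [wmat_append, hmap, hwl, List.map_cons, List.prod_cons]

end Boundary

/-! ## 5. Unit rigidity for chains of unit links -/

section Main

variable {m c : ℕ}

/-- **UNIT RIGIDITY.** For `c < m`, over any field, a width-2 chain `uᵀ M_1(ℓ_1) ⋯ M_N(ℓ_N) v` of UNIT
univariate-image links (`M_j ∈ GL₂(K[t])`, `|vars ℓ_j| ≤ c`) that is a multiple of `per_m` is zero — any
length `N`. (Sharp at `c = m = 2`: `DefinabilityGapZperTransfer.zperHits_two_fails` uses unit links.) [this file] -/
theorem chainVal_eq_zero_of_isUnit_det (hcm : c < m)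
    (l : List (Matrix (Fin 2) (Fin 2) (Polynomial K) × MvPolynomial (Fin m × Fin m) K))
    (hloc : ∀ e ∈ l, ∃ S : Finset (Fin m × Fin m), S.card ≤ c ∧ e.2.vars ⊆ S)
    (hunit : ∀ e ∈ l, IsUnit e.1.det) (u v : Fin 2 → K) (H : MvPolynomial (Fin m × Fin m) K)
    (h : chainVal (l.map ulink) u v = perPoly (Fin m) K * H) : chainVal (l.map ulink) u v = 0 := by
  by_cases hu : u = 0
  · subst hu
    simp [chainVal]
  by_cases hv : v = 0
  · subst hv
    simp [chainVal, Matrix.mulVec, dotProduct]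
  obtain ⟨U, hU, hUrow⟩ := exists_row_word (Fin m × Fin m) c u hu
  obtain ⟨V, hV, hVcol⟩ := exists_col_word (Fin m × Fin m) c v hv
  obtain ⟨w, hw, hwl⟩ := exists_word_links l hloc hunit
  have hentry : wmat K (U ++ w ++ V) 0 1 = chainVal (l.map ulink) u v := by
    rw [wmat_append, wmat_append, hwl]
    exact entry_eq_chainVal _ _ _ u v hUrow hVcol
  have hT : ∀ t ∈ U ++ w ++ V, t.1 ∈ locSpan K (Fin m × Fin m) c ∧ t.2.1 ≠ 0 ∧ t.2.2 ≠ 0 := by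
    intro t ht
    simp only [List.mem_append] at ht
    rcases ht with (ht | ht) | ht
    exacts [hU t ht, hw t ht, hV t ht]
  rw [← hentry]
  refine wmat_zero_one_eq_zero hcm (U ++ w ++ V) hT ?_
  rw [hentry, h]
  exact dvd_mul_right _ _

/-- The unit-links sub-case of the leaf `ZperHits₂(m)` (hypothesis `hZ` of
`DefinabilityGapZperTransfer.chainVal_eq_zero_of_bind₁_kiPer`), for every `m ≥ 3` and every field. [this file] -/
theorem zperHits_of_isUnit_det (hm : 3 ≤ m) (F : Type*) [Field F]
    (l : List (Matrix (Fin 2) (Fin 2) (Polynomial F) × MvPolynomial (Fin m × Fin m) F))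
    (hloc : ∀ e ∈ l, ∃ S : Finset (Fin m × Fin m), S.card ≤ 2 ∧ e.2.vars ⊆ S)
    (hunit : ∀ e ∈ l, IsUnit e.1.det) :
    ∀ (u v : Fin 2 → F) (H : MvPolynomial (Fin m × Fin m) F),
      chainVal (l.map ulink) u v = perPoly (Fin m) F * H → chainVal (l.map ulink) u v = 0 :=
  fun u v H h => chainVal_eq_zero_of_isUnit_det (by omega) l hloc hunit u v H h

end Main

end

end Summit.ValiantsHypothesis.ValiantsHypothesis.Theorems.DefinabilityGapUnitRigidity
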